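import Literature.MathematicalPhysics.QuantumFieldTheory.Balaban1983to89.B9Eq3126H1kLipschitzSlotDiagonal
import Literature.MathematicalPhysics.QuantumFieldTheory.Balaban1983to89.B9Eq3153FrakGkLipschitzSlotDiagonal
import Literature.MathematicalPhysics.QuantumFieldTheory.Balaban1983to89.B9Eq3120DeltaPiPrimeFormTwoWindows

/-!
# `Balaban1983to89.B9Eq3126LipschitzPiTwoWindows` — T. Bałaban, *Propagators for lattice gauge theories in a background field*, Commun. Math. Phys. **99** (1985)
# 389–434 [Balaban1985BackgroundPropagators] (3.126) p. 420, (3.153) ∕ Thm 3.13 p. 426, (3.122) p. 420, (3.130) p. 421, Thm 3.11 p. 416 and the class (3.35) p. 396,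
# ON PRINT's DIAGONAL `ηL^{n+1} = 1`: **PRINT's `H̃_{1,k}` (3.126) AND `𝔊̃_k` (3.153) — THE LETTERS OF `Δ̃_{a,k}(U)` (3.122) (`B9Eq3119DeltaPiTower.laplaceAkPi`) — DIFFER
# FROM THE CHAIN's `H_{1,k}(U)`, `𝔊_k(U)` BY `O(α)` IN THE FLAT ENERGY NORM ON PRINT's CLASS (3.35)** — this lineage's abstract-slot `B9Eq3126H1kLipschitzSlotDiagonal` ∕
# `B9Eq3153FrakGkLipschitzSlotDiagonal` at print's slot, the form letter `θ := θα` INHABITED by `B9Eq3120DeltaPiPrimeFormTwoWindows` §1 and the level profile STRUCK by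
# the α-linear two-window feed; `C_K` (the chain's K-floor at `U`), `M_Q` and the symmetries displayed

statement-level skeleton of published theorems with citation tags; proofs where landed; nothing here is a claim about the Yang–Mills mass gap

CITATION HEADER (lean-in-tree rule).  Audit cell `pub-balaban`, sub-cell `t4`, BINDER row NE9; filed by NE9 crux-team (2) leaf prover 03
(`b2b-balaban-t4-ne9-formalise-leaf-03`, gen 67), INTENT I-ne9leaf03-g67-G (the END of O-3, the OWNER t4-ne9-p1's W-8 (γ) «then your two-window∕named END»).
Sources READ in the held text `paper:balaban1985-cmp99-background-propagators` (journal page = PDF page + 388) pp. 396, 416, 419–421, 426.  Objects BY NAME: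
`laplaceAkPi`, `laplaceAk`, `laplacePrimeAk`, `H1LatticeK`, `frakGLatticeK`, `KinvLatticeK`, `QkW`, `covCurlL2K`, `covDivL2K`; nothing re-declared, 0 `def`.

THE PRINT (verbatim).  p. 420: *«HB = GQ*(QGQ*)⁻¹B (3.126) … we will prove that this term is a small perturbation of Δ_a, and that the operator G used in the
above formula has all the properties formulated in Theorems 3.3, 3.10, 3.11»*; p. 426: *«(3.147), (3.153) permit us to reduce properties of 𝔓, 𝔊 to the corresponding
properties of G′, (Q′G′²Q′*)⁻¹, G₁, (QG₁Q*)⁻¹»*; p. 396: the class (3.35).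

WHY THIS FILE (cell context).  With `B9Eq3120DeltaPiPrimeFormTwoWindows` ((3.130): `G̃_k − G_k = O(α)`), this file completes the port's step (iv) on print's class:
print's `H` and `𝔊` letters against the chain's at the SAME background.  Combined with the chain's two-background rows (`X_k(U) − X_k(1) = O(α)`, the energy ball) and
`B9Eq3119DeltaPiTowerFlat` (`Δ̃_{a,k}(1) = Δ_{a,k}(1)`), print's letters satisfy the two-background Lipschitz rows NE9's chart consumes, by the triangle inequality.

WHAT IS PROVED (sorry-free; proof lane — 0 `def`; [folklore] binder plumbing + one threshold).  Binders: the two-window class (E162's data for `Q_k`, `S` averaging-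
closed, `hRS`, bonds `αη`, plaquettes `αη²`, `ρ_w`), `hpos′`, then the witnesses.
* §1 **`exists_norm_H1k_pi_sub_le_twoWindows`** — `∃ α₀ C > 0` first; `∀ hpos₁ hposU hQ {C_K} (0 ≤ C_K) hK b`: `‖P(H1LatticeK hpos₁ hQ b − H1LatticeK hposU hQ b)‖ ≤
  C·√C_K·α·‖b‖`, `P ∈ {1, curl₁, div₁}`, `hpos₁` a witness for `laplaceAkPi …`, `hposU` for `laplaceAk …` — PRINT's `H̃_{1,k}(U) − H_{1,k}(U) = O(α)`.
* §2 **`exists_norm_frakGk_pi_sub_le_twoWindows`** (section letters `C_K`, `M_Q ≥ 0`) — `∃ α₀ C > 0` first; `∀ hsymm hsymmU hpos₁ hposU hQ hK hQb x`: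
  `‖P(frakGLatticeK hpos₁ hQ x − frakGLatticeK hposU hQ x)‖ ≤ C·α·‖x‖` — PRINT's `𝔊̃_k(U) − 𝔊_k(U) = O(α)`.
HONEST SCOPE.  [folklore]; `C_K`, `M_Q`, the symmetries, `hpos′` and the witnesses DISPLAYED (all inhabited on the class by tree files: leaf-02's K-floor, the `Q_k` norm
letters, `laplaceAkPi_isSymmetric` ∕ `laplaceAk_isSymmetric` on the unitary class, `B9Eq3120DeltaPiPrimeFormTwoWindows` §3 (b)); the two WINDOWS, E162's data, `hRS`,
`ρ_w` HYPOTHESES; the fine-bond window NOT derived from plaquettes; FIRST order, energy currency on the diagonal — no kernel bound, no decay, NOT the (N)-reading.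
«NE9 ⇐ the named binders»; NE9 NOT PRINTED ∕ NOT PROVED; NOT summit progress (cell pub-balaban: row NE9 WALLED ON A MODEL (O-NE9-1; #5 UNRULED); spine PROVED 0/9;
rung (B)+1 finite T⁴ — NOT infinite volume, NOT mass gap, NOT BetaPertH, NOT Clay; HONEST DEPENDENCY: continuum YM on T⁴ ⇐ BetaPertH ∧ nine spine estimates (0/9
proved); BetaPertH ⇐ (D1) ∧ (D4) ∧ CAP+tail; G-an2-4 gates asym, D1 and NE2/3/4).  NEW file; nothing modified.  Net new unproved facts: 0.
-/

noncomputable section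

open scoped InnerProductSpace ComplexConjugate BigOperators

namespace Literature.MathematicalPhysics.QuantumFieldTheory.Balaban1983to89.B9Eq3126LipschitzPiTwoWindows

open B4Sect5Torus (TSite)
open B9SectCLatticeCarrier (Bond)
open B11Eq103H1Complex (SiteL2K BondL2K covDerivL2K covDivL2K laplaceALatticeK H1LatticeK frakGLatticeK KinvLatticeK)
open B9Eq310HessianOperator (adTransportW hessOp covCurlL2K)
open B9Eq310DeltaPrime (plaqHolU)
open B9Eq315QTorus (perCfg cornerSite)
open B9Eq315QTower (towerP UlevOf)
open B9Eq326OperatorTower (laplaceAk QkW RofUk)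
open B9Eq324DeltaPrimeATower (laplacePrimeAk GpOfUk)
open B9Eq3119DeltaPiTower (piOfUk laplaceAkPi)
open B7Prop1Explicit (U1 Wcx boxVec)
open B7Prop2Explicit (AvgClosed)
open B9Eq3126H1kLipschitzSlotDiagonal (exists_norm_H1k_slot_sub_le_diagonal)
open B9Eq3153FrakGkLipschitzSlotDiagonal (exists_norm_frakGk_slot_sub_le_diagonal)
open B9Eq3120DeltaPiPrimeFormTwoWindows (exists_form_defect_pi_twoWindows)
open B7Eq43AveragedSmallnessLinearFeed (twoWindows_linear_feed)

/-- The thresholds shared by §1–§2: `α ≤ min T (min α_B (γ₁∕(2θ)))` gives `α ≤ T`, `α ≤ α_B`, `0 ≤ θα ≤ γ₁∕2`. [folklore] -/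
private theorem thresholds {γ₁ θ T αB α : ℝ} (hθ : 0 < θ)
    (hαle : α ≤ min T (min αB (γ₁ / (2 * θ)))) (hα0 : 0 ≤ α) :
    α ≤ T ∧ α ≤ αB ∧ 0 ≤ θ * α ∧ θ * α ≤ γ₁ / 2 := by
  have hαθ : α ≤ γ₁ / (2 * θ) := hαle.trans ((min_le_right _ _).trans (min_le_right _ _))
  rw [le_div_iff₀ (by positivity : (0 : ℝ) < 2 * θ)] at hαθ
  exact ⟨hαle.trans (min_le_left _ _), hαle.trans ((min_le_right _ _).trans (min_le_left _ _)), by positivity, by linarith⟩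

variable {d : ℕ} (L : ℕ) [NeZero L] (hL : 1 ≤ L) (hL2 : 2 ≤ L)
  {𝔸 : Type*} [NormedRing 𝔸] [NormedAlgebra ℂ 𝔸] [CompleteSpace 𝔸] [NormOneClass 𝔸] [StarRing 𝔸] [NormedStarGroup 𝔸] [StarModule ℂ 𝔸]
  {W : Type*} [NormedAddCommGroup W] [InnerProductSpace ℂ W] [FiniteDimensional ℂ W] (φ : W ≃ₗ[ℂ] 𝔸)
  {Mφ Mφ' : ℝ} (hMφ : 0 ≤ Mφ) (hMφ' : 0 ≤ Mφ') (hφ : ∀ w, ‖φ w‖ ≤ Mφ * ‖w‖) (hφ' : ∀ X, ‖φ.symm X‖ ≤ Mφ' * ‖X‖)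
  {a : ℝ} (ha : 0 < a) {a' : ℝ} (ha' : 0 < a') (τ : 𝔸 →ₗ[ℂ] ℂ) {Cτ : ℝ} (hτ : ∀ X, ‖τ X‖ ≤ Cτ * ‖X‖) (hCτ : 0 ≤ Cτ) {ρw : ℝ} (hρw : 0 ≤ ρw)
  {CK MQ : ℝ} (hCK : 0 ≤ CK) (hMQ : 0 ≤ MQ)

/-! ## §1 Print's `H̃_{1,k}(U) − H_{1,k}(U) = O(α)` in the flat energy norm on print's class -/

include hL2 hMφ hMφ' hφ hφ' ha ha' hτ hCτ hρw in
set_option maxRecDepth 8192 in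
/-- **PRINT's MINIMISER (3.126) AGAINST THE CHAIN's ON PRINT's CLASS (3.35)** — see the module header; `B9Eq3126H1kLipschitzSlotDiagonal.exists_norm_H1k_slot_sub_le_diagonal`
at `r = 1∕L`, `β = Kα`, `Δ₁ :=` print's slot (unified from the θ-letter, `laplaceAkPi` named by `rfl`), `θ := θα ≤ γ₁∕2`. [folklore]
[cite: Balaban1985BackgroundPropagators, (3.126) p.420, (3.130) p.421, (3.122) p.420, Thm 3.11 p.416, (3.35)–(3.37) p.396; Balaban1985Variational, (45)–(46) p.285; Balaban1985Averaging, Prop. 2 (52)–(54) p.26] -/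
theorem exists_norm_H1k_pi_sub_le_twoWindows :
    ∃ α₀ C : ℝ, 0 < α₀ ∧ 0 < C ∧ ∀ (n : ℕ) (η : ℝ), η * (L : ℝ) ^ (n + 1) = 1 →
      ∀ (c₀ c₁ : ℝ) [Fact (0 < c₀)] [Fact (0 < c₁)], c₀ * ((L : ℝ) ^ (n + 1)) ^ d = c₁ → |η| ^ d / c₀ ≤ ρw →
      ∀ (m : Fin d → ℕ) [∀ i, NeZero (m i)] (U : Bond d (towerP L m (n + 1)) → 𝔸ˣ) (αU : ℕ → ℝ) (hα1 : ∀ j, αU j ≤ 1 / 64)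
        (hU1 : ∀ (j : ℕ) (x : B7Prop1Explicit.Site d) (κ : Fin d), perCfg (towerP L m (j + 1)) (UlevOf L m (n + 1) U j) x κ ∈ U1 𝔸)
        (hreg : ∀ (j : ℕ) (y : TSite d (towerP L m j)) (κ : Fin d) (r : Fin d → Fin L),
          ‖((Wcx L (perCfg (towerP L m (j + 1)) (UlevOf L m (n + 1) U j)) (cornerSite L y) κ (boxVec L r) : 𝔸ˣ) : 𝔸) - 1‖ ≤ αU j)
        {S : Subgroup 𝔸ˣ}, AvgClosed d L S → (∀ b, U b ∈ S) →
      ∀ {α : ℝ}, 0 ≤ α → α ≤ α₀ →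
        (∀ (b : Bond d (towerP L m (n + 1))) (v u : W), ⟪adTransportW φ U b v, u⟫_ℂ = ⟪v, adTransportW φ (fun b => (U b)⁻¹) b u⟫_ℂ) →
        (∀ b, ‖(U b : 𝔸) - 1‖ ≤ α * η) →
        (∀ p : B9SectCLatticeCarrier.Plaq d (towerP L m (n + 1)), ‖(plaqHolU U p : 𝔸) - 1‖ ≤ α * η ^ 2) →
        ∀ (hpos' : ∀ x : SiteL2K ℂ d (towerP L m (n + 1)) c₀ W, x ≠ 0 →
          0 < RCLike.re ⟪x, laplacePrimeAk L m n φ η U a' (c₁ := c₁) x⟫_ℂ)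
          (hpos₁ : ∀ x : BondL2K ℂ d (towerP L m (n + 1)) c₀ W, x ≠ 0 → 0 < RCLike.re ⟪x, laplaceAkPi L m n φ τ η U a' hpos' hL αU hα1 hU1 hreg (c₁ := c₁) a x⟫_ℂ)
          (hposU : ∀ x : BondL2K ℂ d (towerP L m (n + 1)) c₀ W, x ≠ 0 → 0 < RCLike.re ⟪x, laplaceAk L m n φ η U hL αU hα1 hU1 hreg τ (c₀ := c₀) (c₁ := c₁) a x⟫_ℂ)
          (hQ : Function.Surjective (QkW L m n φ U hL αU hα1 hU1 hreg (c₀ := c₀) (c₁ := c₁))) {CK : ℝ}, 0 ≤ CK →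
        (∀ c : BondL2K ℂ d m c₁ W, ‖KinvLatticeK hposU hQ c‖ ≤ CK * ‖c‖) →
        ∀ b : BondL2K ℂ d m c₁ W,
          ‖H1LatticeK hpos₁ hQ b - H1LatticeK hposU hQ b‖ ≤ C * Real.sqrt CK * α * ‖b‖ ∧
          ‖covCurlL2K ℂ c₀ ((η : ℂ))⁻¹ (adTransportW φ (fun _ : Bond d (towerP L m (n + 1)) => (1 : 𝔸ˣ)))
            (H1LatticeK hpos₁ hQ b - H1LatticeK hposU hQ b)‖ ≤ C * Real.sqrt CK * α * ‖b‖ ∧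
          ‖covDivL2K ℂ c₀ ((η : ℂ))⁻¹ (adTransportW φ fun _ : Bond d (towerP L m (n + 1)) => (1 : 𝔸ˣ)⁻¹)
            (H1LatticeK hpos₁ hQ b - H1LatticeK hposU hQ b)‖ ≤ C * Real.sqrt CK * α * ‖b‖ := by
  have hL0 : (0 : ℝ) < L := by exact_mod_cast lt_of_lt_of_le (by norm_num) hL2
  have hr0 : (0 : ℝ) ≤ 1 / (L : ℝ) := by positivity
  have hr1 : 1 / (L : ℝ) < 1 := by rw [div_lt_one hL0]; exact_mod_cast lt_of_lt_of_le (by norm_num) hL2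
  obtain ⟨α₁, γ₁, C, hα₁, hγ₁, hC, H⟩ := exists_norm_H1k_slot_sub_le_diagonal (d := d) L hL φ hMφ hMφ' hφ hφ' ha hr0 hr1 τ hτ hCτ hρw
  obtain ⟨T, hT, F⟩ := twoWindows_linear_feed L hL2 (d := d) (𝔸 := 𝔸) hα₁
  obtain ⟨αB, θ, hαB, hθ, HB⟩ := exists_form_defect_pi_twoWindows (d := d) L hL2 φ hMφ hMφ' hφ hφ' ha' τ hτ hCτ hρw
  have hγθ : 0 < γ₁ / (2 * θ) := by positivity
  refine ⟨min T (min αB (γ₁ / (2 * θ))), C * θ, lt_min hT (lt_min hαB hγθ), by positivity, ?_⟩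
  intro n η hηL c₀ c₁ _ _ hw hρ m _ U αU hα1 hU1 hreg S hS hU α hα0 hαle hRS hUη hpl hpos' hpos₁ hposU hQ CK hCK hK b
  obtain ⟨hαT, hαB', hθα0, hθαle⟩ := thresholds hθ hαle hα0
  obtain ⟨hβ0, hβ1, hUb, hUη', hpl', hU1', εU, hεU, hUε, hεg⟩ := F m n hS hU hηL hα0 hαT hUη hpl
  have hform := HB n η hηL c₀ c₁ hw hρ m U hRS hS hU α hα0 hαB' hUη hpl hpos'
  obtain ⟨h1, h2, h3⟩ := H n η hηL c₀ c₁ hw hρ m U αU hα1 hU1 hreg εU hεU hUε hβ0 hβ1 hRS hUb hUη' hpl' hεg _ hθα0 hθαle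
    (fun u v => hform u v) hpos₁ hposU hQ hCK hK b
  have e : C * Real.sqrt CK * (θ * α) * ‖b‖ = C * θ * Real.sqrt CK * α * ‖b‖ := by ring
  exact ⟨h1.trans_eq e, h2.trans_eq e, h3.trans_eq e⟩

/-! ## §2 Print's `𝔊̃_k(U) − 𝔊_k(U) = O(α)` in the flat energy norm on print's class -/

include hL2 hMφ hMφ' hφ hφ' ha ha' hτ hCτ hρw hCK hMQ in
set_option maxRecDepth 8192 in
/-- **PRINT's THIRD GREEN's LETTER (3.153) AGAINST THE CHAIN's ON PRINT's CLASS (3.35)** — see the module header; `B9Eq3153FrakGkLipschitzSlotDiagonal.exists_norm_frakGk_slot_sub_le_diagonal`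
at `r = 1∕L`, `β = Kα`, `Δ₁ :=` print's slot, `θ := θα ≤ γ₁∕2`; `C_K`, `M_Q`, the two symmetries displayed. [folklore]
[cite: Balaban1985BackgroundPropagators, (3.153) p.426, Thm 3.13 p.426, (3.130) p.421, (3.122) p.420, Thm 3.11 p.416, (3.35)–(3.37) p.396; Balaban1985Variational, (110)–(111) p.294; Balaban1985Averaging, Prop. 2 (52)–(54) p.26] -/
theorem exists_norm_frakGk_pi_sub_le_twoWindows :
    ∃ α₀ C : ℝ, 0 < α₀ ∧ 0 < C ∧ ∀ (n : ℕ) (η : ℝ), η * (L : ℝ) ^ (n + 1) = 1 →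
      ∀ (c₀ c₁ : ℝ) [Fact (0 < c₀)] [Fact (0 < c₁)], c₀ * ((L : ℝ) ^ (n + 1)) ^ d = c₁ → |η| ^ d / c₀ ≤ ρw →
      ∀ (m : Fin d → ℕ) [∀ i, NeZero (m i)] (U : Bond d (towerP L m (n + 1)) → 𝔸ˣ) (αU : ℕ → ℝ) (hα1 : ∀ j, αU j ≤ 1 / 64)
        (hU1 : ∀ (j : ℕ) (x : B7Prop1Explicit.Site d) (κ : Fin d), perCfg (towerP L m (j + 1)) (UlevOf L m (n + 1) U j) x κ ∈ U1 𝔸)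
        (hreg : ∀ (j : ℕ) (y : TSite d (towerP L m j)) (κ : Fin d) (r : Fin d → Fin L),
          ‖((Wcx L (perCfg (towerP L m (j + 1)) (UlevOf L m (n + 1) U j)) (cornerSite L y) κ (boxVec L r) : 𝔸ˣ) : 𝔸) - 1‖ ≤ αU j)
        {S : Subgroup 𝔸ˣ}, AvgClosed d L S → (∀ b, U b ∈ S) →
      ∀ {α : ℝ}, 0 ≤ α → α ≤ α₀ →
        (∀ (b : Bond d (towerP L m (n + 1))) (v u : W), ⟪adTransportW φ U b v, u⟫_ℂ = ⟪v, adTransportW φ (fun b => (U b)⁻¹) b u⟫_ℂ) →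
        (∀ b, ‖(U b : 𝔸) - 1‖ ≤ α * η) →
        (∀ p : B9SectCLatticeCarrier.Plaq d (towerP L m (n + 1)), ‖(plaqHolU U p : 𝔸) - 1‖ ≤ α * η ^ 2) →
        ∀ (hpos' : ∀ x : SiteL2K ℂ d (towerP L m (n + 1)) c₀ W, x ≠ 0 →
          0 < RCLike.re ⟪x, laplacePrimeAk L m n φ η U a' (c₁ := c₁) x⟫_ℂ),
        (laplaceAkPi L m n φ τ η U a' hpos' hL αU hα1 hU1 hreg (c₁ := c₁) a).IsSymmetric →
        (laplaceAk L m n φ η U hL αU hα1 hU1 hreg τ (c₀ := c₀) (c₁ := c₁) a).IsSymmetric →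
        ∀ (hpos₁ : ∀ x : BondL2K ℂ d (towerP L m (n + 1)) c₀ W, x ≠ 0 → 0 < RCLike.re ⟪x, laplaceAkPi L m n φ τ η U a' hpos' hL αU hα1 hU1 hreg (c₁ := c₁) a x⟫_ℂ)
          (hposU : ∀ x : BondL2K ℂ d (towerP L m (n + 1)) c₀ W, x ≠ 0 → 0 < RCLike.re ⟪x, laplaceAk L m n φ η U hL αU hα1 hU1 hreg τ (c₀ := c₀) (c₁ := c₁) a x⟫_ℂ)
          (hQ : Function.Surjective (QkW L m n φ U hL αU hα1 hU1 hreg (c₀ := c₀) (c₁ := c₁))),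
        (∀ c : BondL2K ℂ d m c₁ W, ‖KinvLatticeK hposU hQ c‖ ≤ CK * ‖c‖) →
        (∀ w : BondL2K ℂ d (towerP L m (n + 1)) c₀ W, ‖QkW L m n φ U hL αU hα1 hU1 hreg (c₀ := c₀) (c₁ := c₁) w‖ ≤ MQ * ‖w‖) →
        ∀ x : BondL2K ℂ d (towerP L m (n + 1)) c₀ W,
          ‖frakGLatticeK hpos₁ hQ x - frakGLatticeK hposU hQ x‖ ≤ C * α * ‖x‖ ∧
          ‖covCurlL2K ℂ c₀ ((η : ℂ))⁻¹ (adTransportW φ (fun _ : Bond d (towerP L m (n + 1)) => (1 : 𝔸ˣ)))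
            (frakGLatticeK hpos₁ hQ x - frakGLatticeK hposU hQ x)‖ ≤ C * α * ‖x‖ ∧
          ‖covDivL2K ℂ c₀ ((η : ℂ))⁻¹ (adTransportW φ fun _ : Bond d (towerP L m (n + 1)) => (1 : 𝔸ˣ)⁻¹)
            (frakGLatticeK hpos₁ hQ x - frakGLatticeK hposU hQ x)‖ ≤ C * α * ‖x‖ := by
  have hL0 : (0 : ℝ) < L := by exact_mod_cast lt_of_lt_of_le (by norm_num) hL2
  have hr0 : (0 : ℝ) ≤ 1 / (L : ℝ) := by positivity
  have hr1 : 1 / (L : ℝ) < 1 := by rw [div_lt_one hL0]; exact_mod_cast lt_of_lt_of_le (by norm_num) hL2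
  obtain ⟨α₁, γ₁, C, hα₁, hγ₁, hC, H⟩ := exists_norm_frakGk_slot_sub_le_diagonal (d := d) L hL φ hMφ hMφ' hφ hφ' ha hr0 hr1 τ hτ hCτ hρw hCK hMQ
  obtain ⟨T, hT, F⟩ := twoWindows_linear_feed L hL2 (d := d) (𝔸 := 𝔸) hα₁
  obtain ⟨αB, θ, hαB, hθ, HB⟩ := exists_form_defect_pi_twoWindows (d := d) L hL2 φ hMφ hMφ' hφ hφ' ha' τ hτ hCτ hρw
  have hγθ : 0 < γ₁ / (2 * θ) := by positivity
  refine ⟨min T (min αB (γ₁ / (2 * θ))), C * θ, lt_min hT (lt_min hαB hγθ), by positivity, ?_⟩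
  intro n η hηL c₀ c₁ _ _ hw hρ m _ U αU hα1 hU1 hreg S hS hU α hα0 hαle hRS hUη hpl hpos' hsymm hsymmU hpos₁ hposU hQ hK hQb x
  obtain ⟨hαT, hαB', hθα0, hθαle⟩ := thresholds hθ hαle hα0
  obtain ⟨hβ0, hβ1, hUb, hUη', hpl', hU1', εU, hεU, hUε, hεg⟩ := F m n hS hU hηL hα0 hαT hUη hpl
  have hform := HB n η hηL c₀ c₁ hw hρ m U hRS hS hU α hα0 hαB' hUη hpl hpos'
  obtain ⟨h1, h2, h3⟩ := H n η hηL c₀ c₁ hw hρ m U αU hα1 hU1 hreg εU hεU hUε hβ0 hβ1 hRS hUb hUη' hpl' hεg _ hθα0 hθαle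
    (fun u v => hform u v) hsymm hsymmU hpos₁ hposU hQ hK hQb x
  have e : C * (θ * α) * ‖x‖ = C * θ * α * ‖x‖ := by ring
  exact ⟨h1.trans_eq e, h2.trans_eq e, h3.trans_eq e⟩

end Literature.MathematicalPhysics.QuantumFieldTheory.Balaban1983to89.B9Eq3126LipschitzPiTwoWindows

end
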